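import Summits.BirchSwinnertonDyer.BirchSwinnertonDyer.Theorems.EdixhovenFibreFiveSevenTwistDegreeStepFiveSevenCellFiveII
import Summits.BirchSwinnertonDyer.BirchSwinnertonDyer.Theorems.EdixhovenFibreFiveSevenStarredOptimalManinUnitFiveSevenCellsOfSL2NeronValuesBar
import Summits.BirchSwinnertonDyer.BirchSwinnertonDyer.Theorems.AdditiveKolyvaginRoadIstarIsogenyInvariance
import Summits.BirchSwinnertonDyer.BirchSwinnertonDyer.Theorems.EdixhovenFibreFiveSevenTwistDegreeStepFiveSevenAddvUnitTwist
import Summits.BirchSwinnertonDyer.Rank1Residual.Additive.TwistRamTransport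
import Literature.NumberTheory.EllipticCurves.QuadraticTwistLFunctionProofs
import Literature.NumberTheory.PAdicHodge.DeRhamEllipticIsogeny
import HarnessLib

/-!
# De Rham-ness of `V_pE` at `p ∈ {5, 7}` on the WHOLE additive potentially good locus with `E[p]` irreducible — a THEOREM;
# and its transport along the isogeny class and along the auxiliary unit twist `χ_{q*}`

Cell `pub/bsd-wall`, seat `bsd-line-edix-p1` g19 (LEAD of line `kato_lever`, crux K★ stmt-BirchSwinnertonDyer-22226; this file
`--supports` KP57 stmt-BirchSwinnertonDyer-23810 as a helper). TOOL theorems only (no definition, no named fact, no `sorry`);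
nothing is closed; BSD is not proved by any of this.

WHAT. The de Rham input hDR of Kato's argument (formerly the cite-only Fontaine fact `isDeRham_restrictedRationalTateRep`) was
discharged CELL BY CELL by the line's seats: the three (G)-ordinary starred cells `(5; III*), (7; IV*), (7; II*)`
(`isDeRham_restrictedRationalTateRep_adicCompletion_rat_of_starred_fiveSeven_ordinary`), the three potentially supersingular starred
cells `(5; IV*), (5; II*), (7; III*)` (explicit good models over `ℚ_p(p^{1/e})`, `isDeRham_supersingularCells_of_explicitCapstone` +
`explicitCapstone_holds`), the unstarred cells `(5; III), (7; II), (7; IV)` ((G)-ordinary, `typeGOrd_five_of_padicValInt_eq_three`,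
`typeGOrd_seven_of_padicValInt_eq_two_or_four`), `(7; III)` (`isDeRham_adicCompletion_rat_seven_of_padicValInt_eq_three`), `(5; IV)`
(`isDeRham_adicCompletion_rat_five_of_padicValInt_eq_four`) and `(5; II)` (by the `5`-twist, `isDeRham_adicCompletion_rat_five_of_padicValInt_eq_two`).
This file assembles them into ONE statement and supplies the transports the KP57 road needs:

* ★★ `isDeRham_adicCompletion_rat_fiveSeven` — for `W/ℚ` globally minimal, `p ∈ {5, 7}`, additive at `p`, `E[p]` irreducible and
  no `Iₙ*` fibre at `p` (i.e. potentially GOOD reduction; `n = 0` included): `V_pW|_{Γ_{ℚ_v}}` is de Rham at the place `v ∣ p`.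
  Split `ord_p Δ_min ≤ 4` (`…_of_le_four`) / `4 < ord_p Δ_min` (`…_of_four_lt`).
* `isDeRham_adicCompletion_rat_fiveSeven_of_isIsogenous` — the same for every globally minimal member of the isogeny class
  (`isDeRham_restrictedRationalTateRep_of_isIsogenous`).
* `kodairaSymbolAt_ne_Istar_of_unitTwist` — «no `Iₙ*` fibre at `p`» passes to any model of the twist `W ⊗ χ_{q*}` by an odd prime
  `q ≠ p` (`q* ≡ 1 (4)` a `p`-adic unit: `Additive.kodairaSymbolAt_eq_of_twist_pStar`).
* ★ `isDeRham_adicCompletion_rat_fiveSeven_of_unitTwist_member` — hence de Rham-ness at `v ∣ p` for EVERY globally minimal member of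
  the class of a globally minimal model `Vχ` of `V₀ ⊗ χ_{q*}`, `V₀ ∼ V`, from the hypotheses of KP57 on `V` (additive, `E[p]` irreducible,
  no `Iₙ*`) — the exact de Rham input of the per-class socket `katoNeronBody_of_sl2NeronValuesBar_of_isDeRhamAt` on the twisted class
  of the Kosters–Pannekoek repair (sequel file `…KPResidueOfReciprocityLaw`).

References: [Fontaine1982FormesDifferentielles] §5 (the statement being re-proved on this locus); [SilvermanAEC2009] VII.5.5, X.5 Cor. 5.4;
[SilvermanATAEC1994] IV.9.4 and Table 4.1; [DokchitserDokchitser2015LocalInvariants] Thm. 3.2; [BrinonConrad2009] Prop. 6.3.8.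
-/

set_option autoImplicit false
-- the Theorems namespace of a single-conjunct summit repeats the summit name by design (D-0017)
set_option linter.dupNamespace false

noncomputable section

open scoped Classical MatrixGroups NumberField

open Polynomial WeierstrassCurve NumberField IsDedekindDomain Field ValuativeRel
  Literature.NumberTheory.EllipticCurves Literature.NumberTheory.EllipticCurves.ModularForms
  Literature.NumberTheory.EllipticCurves.Rank1Residual Literature.NumberTheory.EllipticCurves.Kato2004
  Literature.NumberTheory.DiophantineGeometry Rat.HeightOneSpectrum
  Literature.NumberTheory.PAdicHodge Literature.NumberTheory.GaloisRepresentations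
  Literature.NumberTheory.GaloisRepresentations.IsNonarchimedeanLocalField
  Summit.BirchSwinnertonDyer.Rank1Residual Summit.BirchSwinnertonDyer.Rank1Residual.Additive
  Summit.BirchSwinnertonDyer.BirchSwinnertonDyer.Theorems
  Summit.BirchSwinnertonDyer.BirchSwinnertonDyer.Theorems.TwistDegreeStepFiveSevenOffKPOfReciprocityLaw
  Summit.BirchSwinnertonDyer.BirchSwinnertonDyer.Theorems.TwistDegreeStepFiveSevenSupersingularCellFiveIV
  Summit.BirchSwinnertonDyer.BirchSwinnertonDyer.Theorems.TwistDegreeStepFiveSevenCellFiveII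
  Summit.BirchSwinnertonDyer.BirchSwinnertonDyer.Theorems.StarredOptimalManinUnitFiveSevenSupersingularCellsExplicit
  Summit.BirchSwinnertonDyer.BirchSwinnertonDyer.Theorems.StarredOptimalManinUnitFiveSevenSupersingularCellsDeRhamHolds

namespace Summit.BirchSwinnertonDyer.BirchSwinnertonDyer.Theorems.DeRhamAtFiveSeven

variable {p : ℕ} [hp : Fact p.Prime]

/-! ### §1 De Rham-ness at `p ∈ {5, 7}` on the additive potentially good locus -/

/-- ★ **Unstarred cells** (`ord_p Δ_min ≤ 4`: Kodaira II, III, IV): `V_pW|_{Γ_{ℚ_v}}` is de Rham. Cells `(5; II)` by the `5`-twist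
(`isDeRham_adicCompletion_rat_five_of_padicValInt_eq_two`, with a globally minimal model of `W ⊗ χ₅` from `exists_minimal_twist_pStar`),
`(5; III)` (G)-ordinary, `(5; IV)` explicit model, `(7; III)` explicit model, `(7; II)`/`(7; IV)` (G)-ordinary; `ord_p Δ_min ≥ 2` at an
additive prime. [cite: SilvermanATAEC1994, IV Table 4.1] [cite: Fontaine1982FormesDifferentielles, §5] [cite: BrinonConrad2009, Prop. 6.3.8] -/
theorem isDeRham_adicCompletion_rat_fiveSeven_of_le_four
    (W : WeierstrassCurve ℚ) [W.IsElliptic] [W.IsGloballyMinimal] (hp57 : p = 5 ∨ p = 7) (hadd : Addv W p) (hirr : Irr W p)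
    (hK : ∀ (v : HeightOneSpectrum ℤ) (n : ℕ), natGenerator v = p → W.kodairaSymbolAt v ≠ KodairaSymbol.Istar n)
    (h4 : padicValInt p W.minimalDiscriminantInt ≤ 4)
    (v : HeightOneSpectrum (𝓞 ℚ)) (hpv : ((p : ℕ) : 𝓞 ℚ) ∈ v.asIdeal)
    [CharZero (v.adicCompletion ℚ)] [Fact (¬ IsUnit (p : integerC (v.adicCompletion ℚ)))]
    [IsAdicComplete (Ideal.span {(p : integerC (v.adicCompletion ℚ))}) (integerC (v.adicCompletion ℚ))]
    (hp' : valuation (v.adicCompletion ℚ) p < 1) [Algebra ℚ_[p] (v.adicCompletion ℚ)] :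
    GaloisRep.IsDeRham (bdRPeriodRingData (F := v.adicCompletion ℚ) (p := p) hp')
      (restrictedRationalTateRep W (v.adicCompletion ℚ) p) := by
  have hI : ∀ n : ℕ, W.kodairaSymbolAt (placeOf p) ≠ .Istar n := fun n ↦ hK (placeOf p) n (natGenerator_placeOf_eq p)
  have h2 : 2 ≤ padicValInt p W.minimalDiscriminantInt :=
    MemberManinUnitFiveSevenGlue.two_le_padicValInt_minimalDiscriminantInt_of_addv W (by omega) hadd
  rcases hp57 with h5 | h7
  · by_cases he2 : padicValInt p W.minimalDiscriminantInt = 2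
    · obtain ⟨Wf, _, _, C, hC⟩ := exists_minimal_twist_pStar p W
      exact isDeRham_adicCompletion_rat_five_of_padicValInt_eq_two W Wf C h5 hadd hirr hK he2 hC v hpv hp'
    by_cases he3 : padicValInt p W.minimalDiscriminantInt = 3
    · exact isDeRham_restrictedRationalTateRep_adicCompletion_rat_of_typeGOrd W p
        (typeGOrd_five_of_padicValInt_eq_three W p h5 hadd hI he3) v hpv hp'
    exact isDeRham_adicCompletion_rat_five_of_padicValInt_eq_four W h5 hadd hK (by omega) v hpv hp'
  · by_cases he3 : padicValInt p W.minimalDiscriminantInt = 3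
    · exact isDeRham_adicCompletion_rat_seven_of_padicValInt_eq_three W h7 hadd hK he3 v hpv hp'
    exact isDeRham_restrictedRationalTateRep_adicCompletion_rat_of_typeGOrd W p
      (typeGOrd_seven_of_padicValInt_eq_two_or_four W p h7 hadd hI (by omega)) v hpv hp'

/-- ★ **Starred cells** (`4 < ord_p Δ_min`: Kodaira IV*, III*, II*): `V_pW|_{Γ_{ℚ_v}}` is de Rham. On the half `p = 5 ↔ ord_p Δ_min = 9`
((G)-ordinary: `(5; III*), (7; IV*), (7; II*)`) by `isDeRham_restrictedRationalTateRep_adicCompletion_rat_of_starred_fiveSeven_ordinary`; on the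
three potentially supersingular cells by the explicit-model capstone (`isDeRham_supersingularCells_of_explicitCapstone explicitCapstone_holds`).
[cite: DokchitserDokchitser2015LocalInvariants, Thm. 3.2] [cite: SilvermanAEC2009, VII.5.5] [cite: Fontaine1982FormesDifferentielles, §5] -/
theorem isDeRham_adicCompletion_rat_fiveSeven_of_four_lt
    (W : WeierstrassCurve ℚ) [W.IsElliptic] [W.IsGloballyMinimal] (hp57 : p = 5 ∨ p = 7) (hadd : Addv W p) (hirr : Irr W p)
    (hK : ∀ (v : HeightOneSpectrum ℤ) (n : ℕ), natGenerator v = p → W.kodairaSymbolAt v ≠ KodairaSymbol.Istar n)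
    (h4 : 4 < padicValInt p W.minimalDiscriminantInt)
    (v : HeightOneSpectrum (𝓞 ℚ)) (hpv : ((p : ℕ) : 𝓞 ℚ) ∈ v.asIdeal)
    [CharZero (v.adicCompletion ℚ)] [Fact (¬ IsUnit (p : integerC (v.adicCompletion ℚ)))]
    [IsAdicComplete (Ideal.span {(p : integerC (v.adicCompletion ℚ))}) (integerC (v.adicCompletion ℚ))]
    (hp' : valuation (v.adicCompletion ℚ) p < 1) [Algebra ℚ_[p] (v.adicCompletion ℚ)] :
    GaloisRep.IsDeRham (bdRPeriodRingData (F := v.adicCompletion ℚ) (p := p) hp')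
      (restrictedRationalTateRep W (v.adicCompletion ℚ) p) := by
  by_cases hord : (p = 5 ↔ padicValInt p W.minimalDiscriminantInt = 9)
  · exact isDeRham_restrictedRationalTateRep_adicCompletion_rat_of_starred_fiveSeven_ordinary W p hp57 hadd hK h4 hord v hpv hp'
  · exact isDeRham_supersingularCells_of_explicitCapstone explicitCapstone_holds W p hp57 hadd hirr hK h4 hord v hpv hp'

/-- ★★ **`V_pW|_{Γ_{ℚ_v}}` is de Rham for EVERY `W/ℚ` globally minimal, additive at `p ∈ {5, 7}` with potentially good reduction
(no `Iₙ*` fibre at `p`, `n ≥ 0`) and `E[p]` irreducible** — Fontaine's theorem on this locus, assembled from the line's cell theorems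
(`…_of_le_four`, `…_of_four_lt`). [cite: Fontaine1982FormesDifferentielles, §5] [cite: SilvermanATAEC1994, IV Table 4.1]
[cite: BrinonConrad2009, Prop. 6.3.8] -/
theorem isDeRham_adicCompletion_rat_fiveSeven
    (W : WeierstrassCurve ℚ) [W.IsElliptic] [W.IsGloballyMinimal] (hp57 : p = 5 ∨ p = 7) (hadd : Addv W p) (hirr : Irr W p)
    (hK : ∀ (v : HeightOneSpectrum ℤ) (n : ℕ), natGenerator v = p → W.kodairaSymbolAt v ≠ KodairaSymbol.Istar n)
    (v : HeightOneSpectrum (𝓞 ℚ)) (hpv : ((p : ℕ) : 𝓞 ℚ) ∈ v.asIdeal)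
    [CharZero (v.adicCompletion ℚ)] [Fact (¬ IsUnit (p : integerC (v.adicCompletion ℚ)))]
    [IsAdicComplete (Ideal.span {(p : integerC (v.adicCompletion ℚ))}) (integerC (v.adicCompletion ℚ))]
    (hp' : valuation (v.adicCompletion ℚ) p < 1) [Algebra ℚ_[p] (v.adicCompletion ℚ)] :
    GaloisRep.IsDeRham (bdRPeriodRingData (F := v.adicCompletion ℚ) (p := p) hp')
      (restrictedRationalTateRep W (v.adicCompletion ℚ) p) := by
  by_cases h4 : padicValInt p W.minimalDiscriminantInt ≤ 4
  · exact isDeRham_adicCompletion_rat_fiveSeven_of_le_four W hp57 hadd hirr hK h4 v hpv hp'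
  · exact isDeRham_adicCompletion_rat_fiveSeven_of_four_lt W hp57 hadd hirr hK (by omega) v hpv hp'

/-! ### §2 Along the isogeny class -/

/-- **De Rham-ness at `v ∣ p` for every member `W' ∼ W` of the class** of a globally minimal `W` additive at `p ∈ {5, 7}`, `E[p]`
irreducible, no `Iₙ*` fibre at `p` (`isDeRham_restrictedRationalTateRep_of_isIsogenous`: an isogeny is an isomorphism of `V_p`).
[cite: Fontaine1982FormesDifferentielles, §5] [cite: BrinonConrad2009, Prop. 6.3.8] -/
theorem isDeRham_adicCompletion_rat_fiveSeven_of_isIsogenous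
    (W : WeierstrassCurve ℚ) [W.IsElliptic] [W.IsGloballyMinimal] (hp57 : p = 5 ∨ p = 7) (hadd : Addv W p) (hirr : Irr W p)
    (hK : ∀ (v : HeightOneSpectrum ℤ) (n : ℕ), natGenerator v = p → W.kodairaSymbolAt v ≠ KodairaSymbol.Istar n)
    (W' : WeierstrassCurve ℚ) [W'.IsElliptic] (hiso : IsIsogenous W W')
    (v : HeightOneSpectrum (𝓞 ℚ)) (hpv : ((p : ℕ) : 𝓞 ℚ) ∈ v.asIdeal)
    [CharZero (v.adicCompletion ℚ)] [Fact (¬ IsUnit (p : integerC (v.adicCompletion ℚ)))]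
    [IsAdicComplete (Ideal.span {(p : integerC (v.adicCompletion ℚ))}) (integerC (v.adicCompletion ℚ))]
    (hp' : valuation (v.adicCompletion ℚ) p < 1) [Algebra ℚ_[p] (v.adicCompletion ℚ)] :
    GaloisRep.IsDeRham (bdRPeriodRingData (F := v.adicCompletion ℚ) (p := p) hp')
      (restrictedRationalTateRep W' (v.adicCompletion ℚ) p) :=
  isDeRham_restrictedRationalTateRep_of_isIsogenous hp' hiso (isDeRham_adicCompletion_rat_fiveSeven W hp57 hadd hirr hK v hpv hp')

/-! ### §3 Along the auxiliary unit twist `χ_{q*}` -/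

/-- `q* = (−1)^{(q−1)/2} q` is `4k + 1` for an odd prime `q` (`four_dvd_pStar_sub_one`). [folklore] -/
theorem exists_pStar_eq_four_mul_add_one {q : ℕ} [hq : Fact q.Prime] (hq2 : q ≠ 2) :
    ∃ k : ℤ, ((-1 : ℤ) ^ (q / 2) * q : ℤ) = 4 * k + 1 := by
  obtain ⟨k, hk⟩ := four_dvd_pStar_sub_one (p := q) hq2
  exact ⟨k, by linarith⟩

/-- `q*` is a unit at the place of `ℤ` with generator a prime `p ≠ q`. [folklore] -/
theorem valuation_pStar_eq_one {q : ℕ} [hq : Fact q.Prime] (hqp : q ≠ p) (v : HeightOneSpectrum ℤ) (hv : natGenerator v = p) :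
    v.valuation ℚ ((((-1 : ℤ) ^ (q / 2) * q : ℤ)) : ℚ) = 1 := by
  rw [Literature.NumberTheory.EllipticCurves.Rat.valuation_intCast_eq_one_iff, hv]
  have hpZ : Prime (p : ℤ) := Nat.prime_iff_prime_int.mp hp.out
  intro h
  rcases hpZ.dvd_or_dvd h with h1 | h1
  · have h1' : (p : ℤ) ∣ (-1 : ℤ) ^ (q / 2) := h1
    rcases neg_one_pow_eq_or ℤ (q / 2) with h' | h' <;> rw [h'] at h1'
    · exact hp.out.ne_one (by exact_mod_cast Int.eq_one_of_dvd_one (Int.natCast_nonneg p) h1')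
    · rw [dvd_neg] at h1'
      exact hp.out.ne_one (by exact_mod_cast Int.eq_one_of_dvd_one (Int.natCast_nonneg p) h1')
  · exact hqp (((Nat.prime_dvd_prime_iff_eq hp.out hq.out).mp (Int.natCast_dvd_natCast.mp h1))).symm

/-- **«No `Iₙ*` fibre at `p`» passes to any model of the unit twist `W ⊗ χ_{q*}`** (`q ≠ 2, p` prime): `q* = 4k + 1` is a unit at
the place of `p`, so the Kodaira symbols at that place agree (`Additive.kodairaSymbolAt_eq_of_twist_pStar`).
[cite: SilvermanATAEC1994, IV.9.4 (PDF pp. 344–346)] -/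
theorem kodairaSymbolAt_ne_Istar_of_unitTwist
    (W : WeierstrassCurve ℚ) [W.IsElliptic] {q : ℕ} [Fact q.Prime] (hq2 : q ≠ 2) (hqp : q ≠ p)
    (Wχ : WeierstrassCurve ℚ) (C : VariableChange ℚ) (hC : C • W.quadraticTwist ((((-1 : ℤ) ^ (q / 2) * q : ℤ)) : ℚ) = Wχ)
    (hK : ∀ (v : HeightOneSpectrum ℤ) (n : ℕ), natGenerator v = p → W.kodairaSymbolAt v ≠ KodairaSymbol.Istar n) :
    ∀ (v : HeightOneSpectrum ℤ) (n : ℕ), natGenerator v = p → Wχ.kodairaSymbolAt v ≠ KodairaSymbol.Istar n := by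
  intro v n hv
  obtain ⟨k, hk⟩ := exists_pStar_eq_four_mul_add_one (q := q) hq2
  have hd : v.valuation ℚ ((4 * k + 1 : ℤ) : ℚ) = 1 := by rw [← hk]; exact valuation_pStar_eq_one hqp v hv
  have hC' : C • W.quadraticTwist ((4 * k + 1 : ℤ) : ℚ) = Wχ := by rw [← hk]; exact hC
  rw [Additive.kodairaSymbolAt_eq_of_twist_pStar W v hd C hC']
  exact hK v n hv

/-- ★ **The de Rham input of the per-class socket on the twisted class of the Kosters–Pannekoek repair.** For `V/ℚ` globally minimal,
additive at `p ∈ {5, 7}`, `E[p]` irreducible, no `Iₙ*` fibre at `p`; `V₀ ∼ V` globally minimal; `q ≠ 2, p` prime; `Vχ` a globally minimal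
model of `V₀ ⊗ χ_{q*}`; and `W' ∼ Vχ`: `V_pW'|_{Γ_{ℚ_v}}` is de Rham at `v ∣ p`. (Additivity passes along the class and the unit twist
by `X2.addv_iff_of_isIsogenous` / `AddvUnitTwist.addv_of_model_twist_auxPrime`; no `Iₙ*` passes `V → V₀` by
`forall_kodairaSymbolAt_ne_Istar_of_isIsogenous`, `V₀ → Vχ` by `kodairaSymbolAt_ne_Istar_of_unitTwist`; `E^χ[p]` irreducible by
`hasIrreducibleModPGaloisRep_of_smul_eq_quadraticTwist`; then §1–§2 at `Vχ`.)
[cite: Fontaine1982FormesDifferentielles, §5] [cite: SilvermanAEC2009, X.5 Cor. 5.4] [cite: SilvermanATAEC1994, IV.9.4] -/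
theorem isDeRham_adicCompletion_rat_fiveSeven_of_unitTwist_member
    (V : WeierstrassCurve ℚ) [V.IsElliptic] [V.IsGloballyMinimal] (hp57 : p = 5 ∨ p = 7) (hadd : Addv V p) (hirr : Irr V p)
    (hK : ∀ (v : HeightOneSpectrum ℤ) (n : ℕ), natGenerator v = p → V.kodairaSymbolAt v ≠ KodairaSymbol.Istar n)
    (V₀ : WeierstrassCurve ℚ) [V₀.IsElliptic] [V₀.IsGloballyMinimal] (hiso : IsIsogenous V V₀)
    {q : ℕ} [Fact q.Prime] (hq2 : q ≠ 2) (hqp : q ≠ p)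
    (Vχ : WeierstrassCurve ℚ) [Vχ.IsElliptic] [Vχ.IsGloballyMinimal]
    (C : VariableChange ℚ) (hC : C • V₀.quadraticTwist ((((-1 : ℤ) ^ (q / 2) * q : ℤ)) : ℚ) = Vχ)
    (W' : WeierstrassCurve ℚ) [W'.IsElliptic] (hiso' : IsIsogenous Vχ W')
    (v : HeightOneSpectrum (𝓞 ℚ)) (hpv : ((p : ℕ) : 𝓞 ℚ) ∈ v.asIdeal)
    [CharZero (v.adicCompletion ℚ)] [Fact (¬ IsUnit (p : integerC (v.adicCompletion ℚ)))]
    [IsAdicComplete (Ideal.span {(p : integerC (v.adicCompletion ℚ))}) (integerC (v.adicCompletion ℚ))]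
    (hp' : valuation (v.adicCompletion ℚ) p < 1) [Algebra ℚ_[p] (v.adicCompletion ℚ)] :
    GaloisRep.IsDeRham (bdRPeriodRingData (F := v.adicCompletion ℚ) (p := p) hp')
      (restrictedRationalTateRep W' (v.adicCompletion ℚ) p) := by
  have hp2 : p ≠ 2 := by omega
  -- `Vχ` is additive at `p` with `E^χ[p]` irreducible
  have hadd₀ : Addv V₀ p := (X2.addv_iff_of_isIsogenous (p := p) hiso).mp hadd
  have haddχ : Addv Vχ p := AddvUnitTwist.addv_of_model_twist_auxPrime hp2 Fact.out hqp hadd₀ ⟨C, hC⟩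
  have hirr₀ : Irr V₀ p := (X12.irr_iff_of_isIsogenous hiso p).mp hirr
  have hd0 : ((((-1 : ℤ) ^ (q / 2) * q : ℤ)) : ℚ) ≠ 0 := by
    have : ((-1 : ℤ) ^ (q / 2) * q : ℤ) ≠ 0 :=
      mul_ne_zero (pow_ne_zero _ (by norm_num)) (by exact_mod_cast (Fact.out : q.Prime).ne_zero)
    exact_mod_cast this
  have hC' : C⁻¹ • Vχ = V₀.quadraticTwist ((((-1 : ℤ) ^ (q / 2) * q : ℤ)) : ℚ) := by rw [← hC, inv_smul_smul]
  have hirrχ : Irr Vχ p :=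
    BurungaleSkinnerTianWan2024.hasIrreducibleModPGaloisRep_of_smul_eq_quadraticTwist V₀ Vχ p hd0 hC' hirr₀
  -- no `Iₙ*` along `V ∼ V₀` and along the unit twist
  have hK₀ : ∀ (v : HeightOneSpectrum ℤ) (n : ℕ), natGenerator v = p → V₀.kodairaSymbolAt v ≠ KodairaSymbol.Istar n :=
    IstarIsogenyInvariance.forall_kodairaSymbolAt_ne_Istar_of_isIsogenous hiso hp2 (placeOf p) (natGenerator_placeOf_eq p)
      (fun n ↦ hK (placeOf p) n (natGenerator_placeOf_eq p))
  have hKχ := kodairaSymbolAt_ne_Istar_of_unitTwist V₀ hq2 hqp Vχ C hC hK₀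
  exact isDeRham_adicCompletion_rat_fiveSeven_of_isIsogenous Vχ hp57 haddχ hirrχ hKχ W' hiso' v hpv hp'

end Summit.BirchSwinnertonDyer.BirchSwinnertonDyer.Theorems.DeRhamAtFiveSeven

end
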